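import Summits.NavierStokesRegularity.FluidComputer.ClayBlowupLerayHopfCompletion
import Summits.NavierStokesRegularity.FluidComputer.LeraySupClock
import HarnessLib

/-!
# LERAY'S RATE WITH LERAY'S EXPONENT for every UNFORCED Clay blow-up:
# `c √ν / √(T − t) ≤ ‖u(t)‖_∞` and `c_r ν^{(r+3)/(2r)} (T − t)^{−(r−3)/(2r)} ≤ ‖u(t)‖_{L^r}` at EVERY `t < T`

Cell `ns-blowup`, seat `ns-blowup-ecbridge-2` (g8; the E–C endpoint theory seat). LABEL: E–C typing,
(A)-side (KERNEL — no named fact). WHAT THIS IS NOT: not Navier–Stokes evidence — necessary conditions on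
the UNFORCED inhabitants of the types `ClayBlowup ν` / `DesignedBlowup ν` (exactly the counterexamples to
Fefferman's (A), `exists_unforced_clayBlowup_of_not_navierStokesRegularity`); no inhabitant is claimed.
Companion memo: `run/shared/lean/pub/ns-blowup/ecbridge2/ECBRIDGE-2-MEMO-7.md`.

## Content (row R5 PROPER of MEMO-1, unforced)

MEMO-1 listed Leray's rate as a named fact to type (R5); the lineage's rows so far were the WEAK forms
`not_subTypeI` / `not_subLerayRate` (no rate with an exponent strictly below Leray's — forced, g5). The
tree has since PROVED Leray's theorem itself (`leray_blowup_rate_top_holds`, `leray_blowup_rate_holds`,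
ns.S28) and pub-fluidc's `LeraySupClock.supNorm_clock` / `Lr_clock` discharge its boundedness proviso
for maximal smooth Leray–Hopf solutions. This file puts the SHARP rows on the type:

* **`ClayBlowup.leray_rate_sup`** — an absolute `c > 0` such that for every `ν > 0` and every unforced
  Clay blow-up: `c √ν / √(T − t) ≤ ‖u(t)‖_{L^∞}` for EVERY `t ∈ (0, T)` (Leray 1934, §19 (3.9)); so a
  design with `‖u(t)‖_∞ = V` is at least `c² ν / V²` before its blow-up time, at every instant;
* **`ClayBlowup.leray_rate_Lr`** — for every `3 < r < ∞` a constant `c_r > 0` with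
  `c_r ν^{(r+3)/(2r)} (T − t)^{−(r−3)/(2r)} ≤ ‖u(t)‖_{L^r}` for every `t ∈ (0, T)` (Leray 1934, §22);
* `ClayBlowup.leray_countdown` — the real-number countdown: at every `t ∈ (0, T)` with
  `V = ‖u(t)‖_∞ < ∞`, `c² ν ≤ V² (T − t)`;
* the `DesignedBlowup` twins.

Proof: the Leray–Hopf completion `v` of g7 (`exists_isLerayHopfOn_lifespan`: `v = u` on `[0, T)`,
`IsLerayHopfOn T ν 0 (u 0) v`) is a maximal smooth solution with lifespan `T` (classical on `[0, T)` as
`u` is, `IsClassicalNSSolutionOn.congr_velocity`; a classical continuation of `v` past `T` would continue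
`u`, `not_hasSmoothExtensionPast`), so `supNorm_clock` / `Lr_clock` apply to `v`, whose slices before `T`
are those of `u`.

References: J. Leray, Acta Math. 63 (1934), §19 (3.8)–(3.9), §22 [cite: Leray1934, §19 (3.9)];
W. S. Ożański, B. C. Pooley, LMS Lect. Note Ser. 452 (2018), Cor. 6.25 [cite: OzanskiPooley2018, Cor. 6.25];
C. L. Fefferman, Clay problem description, (A) [cite: FeffermanClay2006, (A)].
-/

noncomputable section

namespace Summit.NavierStokesRegularity.FluidComputer

open Set MeasureTheory Filter Topology Function Metric
open scoped ENNReal ContDiff NNReal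
open Literature.Analysis.FluidPDE
open Summit.NavierStokesRegularity.NavierStokesRegularity

namespace ClayBlowup

variable {ν : ℝ} (X : ClayBlowup ν)

/-- **The Leray–Hopf completion of an unforced Clay blow-up is a maximal smooth solution with the same
lifespan** (`ν > 0`, `f = 0`): there is `v` with `v = u` on `[0, T)`, `IsMaximalSmoothSolution ν 0 v p T`
and `IsLerayHopfOn T ν 0 (v 0) v` — the hypotheses of the tree's Leray clocks. [cite: Leray1934, §31–§33] -/
theorem exists_maximal_lerayHopf (hν : 0 < ν) (hf : X.f = 0) :
    ∃ v : ℝ → EuclideanSpace ℝ (Fin 3) → EuclideanSpace ℝ (Fin 3),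
      (∀ t ∈ Ico 0 X.T, v t = X.u t) ∧ IsMaximalSmoothSolution ν 0 v X.p X.T ∧
        IsLerayHopfOn X.T ν 0 (v 0) v := by
  have hT := X.T_pos
  obtain ⟨v, hvu, hv⟩ := X.exists_isLerayHopfOn_lifespan hν hf
  have hcl : IsClassicalNSSolutionOn (Ico 0 X.T) ν 0 v X.p := by
    have h := X.classical
    rw [hf] at h
    exact h.congr_velocity hvu
  have hv0 : v 0 = X.u 0 := hvu 0 ⟨le_rfl, hT⟩
  refine ⟨v, hvu, ⟨hcl, fun hext => ?_⟩, by rw [hv0]; exact hv⟩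
  obtain ⟨T', hT', u', p', hcl', hu'⟩ := hext
  have hext' : HasSmoothExtensionPast ν X.f X.u X.T := by
    rw [hf]
    exact ⟨T', hT', u', p', hcl', fun t ht => (hu' t ht).trans (hvu t ht)⟩
  exact X.not_hasSmoothExtensionPast hν hext'

end ClayBlowup

/-- **LERAY'S `L^∞` RATE FOR EVERY UNFORCED CLAY BLOW-UP** (no named fact): there is an absolute `c > 0`
such that for every `ν > 0`, every `X : ClayBlowup ν` with `X.f = 0` and every `t ∈ (0, T)`,
`c √ν / √(T − t) ≤ ‖u(t)‖_{L^∞(ℝ³)}` (in `ℝ≥0∞`). Leray 1934, §19 (3.9): «V(t) > A√(ν/(T − t))»; the tree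
theorem `leray_blowup_rate_top_holds` through pub-fluidc's `supNorm_clock` on the maximal Leray–Hopf
completion (`ClayBlowup.exists_maximal_lerayHopf`). [cite: Leray1934, §19 (3.9)] [cite: OzanskiPooley2018, Cor. 6.25] -/
theorem ClayBlowup.leray_rate_sup :
    ∃ c : ℝ, 0 < c ∧ ∀ {ν : ℝ}, 0 < ν → ∀ X : ClayBlowup ν, X.f = 0 →
      ∀ t ∈ Ioo 0 X.T,
        ENNReal.ofReal (c * Real.sqrt ν / Real.sqrt (X.T - t)) ≤ eLpNorm (X.u t) ⊤ volume := by
  obtain ⟨c, hc, H⟩ := LeraySupClock.supNorm_clock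
  refine ⟨c, hc, fun {ν} hν X hf t ht => ?_⟩
  obtain ⟨v, hvu, hmax, hLH⟩ := X.exists_maximal_lerayHopf hν hf
  have h := H ν X.T hν X.T_pos v X.p hmax hLH t ht
  rwa [hvu t ⟨ht.1.le, ht.2⟩] at h

/-- **LERAY'S `L^r` RATES FOR EVERY UNFORCED CLAY BLOW-UP** (`3 < r < ∞`; no named fact): for every such
`r` there is `c_r > 0` with `c_r ν^{(r+3)/(2r)} (T − t)^{−(r−3)/(2r)} ≤ ‖u(t)‖_{L^r(ℝ³)}` for every `ν > 0`,
every unforced `X : ClayBlowup ν` and every `t ∈ (0, T)`. Leray 1934, §22; tree theorem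
`leray_blowup_rate_holds` through `Lr_clock`. [cite: Leray1934, §22 (p. 227)] [cite: OzanskiPooley2018, Cor. 6.25] -/
theorem ClayBlowup.leray_rate_Lr (r : ℝ) (hr : 3 < r) :
    ∃ c : ℝ, 0 < c ∧ ∀ {ν : ℝ}, 0 < ν → ∀ X : ClayBlowup ν, X.f = 0 →
      ∀ t ∈ Ioo 0 X.T,
        ENNReal.ofReal (c * ν ^ ((r + 3) / (2 * r)) * (X.T - t) ^ (-((r - 3) / (2 * r)))) ≤
          eLpNorm (X.u t) (ENNReal.ofReal r) volume := by
  obtain ⟨c, hc, H⟩ := LeraySupClock.Lr_clock r hr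
  refine ⟨c, hc, fun {ν} hν X hf t ht => ?_⟩
  obtain ⟨v, hvu, hmax, hLH⟩ := X.exists_maximal_lerayHopf hν hf
  have h := H ν X.T hν X.T_pos v X.p hmax hLH t ht
  rwa [hvu t ⟨ht.1.le, ht.2⟩] at h

/-- **THE COUNTDOWN**: for an unforced Clay blow-up, at every `t ∈ (0, T)` with finite
`V = ‖u(t)‖_{L^∞}`, the time to blow-up satisfies `c² ν ≤ V² (T − t)` (real form of `leray_rate_sup`;
`c` the absolute constant there). [cite: Leray1934, §19 (3.8)] -/
theorem ClayBlowup.leray_countdown :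
    ∃ c : ℝ, 0 < c ∧ ∀ {ν : ℝ}, 0 < ν → ∀ X : ClayBlowup ν, X.f = 0 →
      ∀ t ∈ Ioo 0 X.T, eLpNorm (X.u t) ⊤ volume ≠ ⊤ →
        c ^ 2 * ν ≤ (eLpNorm (X.u t) ⊤ volume).toReal ^ 2 * (X.T - t) := by
  obtain ⟨c, hc, H⟩ := ClayBlowup.leray_rate_sup
  refine ⟨c, hc, fun {ν} hν X hf t ht hfin => ?_⟩
  have h := H hν X hf t ht
  have hTt : 0 < X.T - t := sub_pos.2 ht.2
  have hsq : 0 < Real.sqrt (X.T - t) := Real.sqrt_pos.2 hTt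
  set V : ℝ := (eLpNorm (X.u t) ⊤ volume).toReal with hV
  have hV0 : 0 ≤ V := ENNReal.toReal_nonneg
  have hle : c * Real.sqrt ν / Real.sqrt (X.T - t) ≤ V := by
    have := (ENNReal.ofReal_le_iff_le_toReal hfin).1 h
    exact this
  have hle' : c * Real.sqrt ν ≤ V * Real.sqrt (X.T - t) := (div_le_iff₀ hsq).1 hle
  have hcν : 0 ≤ c * Real.sqrt ν := by positivity
  have hsq2 := mul_self_le_mul_self hcν hle'
  have e1 : c * Real.sqrt ν * (c * Real.sqrt ν) = c ^ 2 * ν := by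
    have : Real.sqrt ν * Real.sqrt ν = ν := Real.mul_self_sqrt hν.le
    calc c * Real.sqrt ν * (c * Real.sqrt ν) = c ^ 2 * (Real.sqrt ν * Real.sqrt ν) := by ring
      _ = c ^ 2 * ν := by rw [this]
  have e2 : V * Real.sqrt (X.T - t) * (V * Real.sqrt (X.T - t)) = V ^ 2 * (X.T - t) := by
    have : Real.sqrt (X.T - t) * Real.sqrt (X.T - t) = X.T - t := Real.mul_self_sqrt hTt.le
    calc V * Real.sqrt (X.T - t) * (V * Real.sqrt (X.T - t))
        = V ^ 2 * (Real.sqrt (X.T - t) * Real.sqrt (X.T - t)) := by ring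
      _ = V ^ 2 * (X.T - t) := by rw [this]
  rw [e1, e2] at hsq2
  exact hsq2

namespace DesignedBlowup

variable {ν : ℝ} (D : DesignedBlowup ν)

/-- **Leray's `L^∞` rate for every unforced designed blow-up** (`toClayBlowup`).
[cite: Leray1934, §19 (3.9)] -/
theorem leray_rate_sup :
    ∃ c : ℝ, 0 < c ∧ ∀ {ν : ℝ}, 0 < ν → ∀ D : DesignedBlowup ν, D.f = 0 →
      ∀ t ∈ Ioo 0 D.T,
        ENNReal.ofReal (c * Real.sqrt ν / Real.sqrt (D.T - t)) ≤ eLpNorm (D.u t) ⊤ volume := by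
  obtain ⟨c, hc, H⟩ := ClayBlowup.leray_rate_sup
  exact ⟨c, hc, fun {ν} hν D hf t ht => H hν D.toClayBlowup hf t ht⟩

/-- **Leray's `L^r` rates for every unforced designed blow-up** (`3 < r < ∞`). [cite: Leray1934, §22 (p. 227)] -/
theorem leray_rate_Lr (r : ℝ) (hr : 3 < r) :
    ∃ c : ℝ, 0 < c ∧ ∀ {ν : ℝ}, 0 < ν → ∀ D : DesignedBlowup ν, D.f = 0 →
      ∀ t ∈ Ioo 0 D.T,
        ENNReal.ofReal (c * ν ^ ((r + 3) / (2 * r)) * (D.T - t) ^ (-((r - 3) / (2 * r)))) ≤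
          eLpNorm (D.u t) (ENNReal.ofReal r) volume := by
  obtain ⟨c, hc, H⟩ := ClayBlowup.leray_rate_Lr r hr
  exact ⟨c, hc, fun {ν} hν D hf t ht => H hν D.toClayBlowup hf t ht⟩

end DesignedBlowup

end Summit.NavierStokesRegularity.FluidComputer

end
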